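import Mathlib
import HarnessLib
import Summits.Ventures.LatticeQCDFlow.Exactness.NCMCGeneralSpaceTwoSampleCLT

/-!
# Unequal sample sizes for two-sample estimators: the CLT over blocks of `a` forward and `b` reverse evolutions

HONEST FRAMING: exact (Metropolis-corrected) sampling algorithms for lattice gauge theory;
figures of merit are autocorrelation/cost numbers at stated couplings and volumes; no
continuum-physics claim.

Venture `LatticeQCDFlow` (cell pub-lqcd), topic `Exactness`; FANOUT row 13 (`eng-snf`, GEN-14).
NEW WORK of the cell (elementary asymptotic statistics on product laws: Mathlib's CLT via the cell's
ratio delta method, `variance_sum_pi`, `indepFun_prod`), not a published result; nothing is cited as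
a fact (C. H. Bennett 1976 named only).  Continuation of `NCMCGeneralSpaceTwoSampleCLT.lean`
(GEN-12), whose NOT-CLAIMED list reads "equal sample sizes and independent pairs only (unequal
`nf ≠ nr` needs a two-index limit)".  THIS file removes the restriction for every FIXED RATIO of
sample sizes `nf : nr = a : b` by grouping the independent evolutions into i.i.d. BLOCKS of `a`
forward and `b` reverse records: after `n` blocks the two-sample estimator uses `a·n` forward and
`b·n` reverse evolutions, and the one-index CLT along `n` applies to the block sums.

## Setting and content

* `measurable_blockSum`, `memLp_blockSum`, `integral_blockSum`, `variance_blockSum` — a block sum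
  `x ↦ Σ_{l<m} g(x l)` on `(Fin m → E, μ^{⊗m})`: measurable, in `L²`, mean `m E_μ g`, variance
  `m Var_μ g` (Mathlib's `variance_sum_pi`); `variance_fst_sub_mul_snd'` — on a product of two
  probability spaces `Var[f(x) − θ g(y)] = Var f + θ² Var g` (two-type version of GEN-12's lemma).
* For a Crooks pair `(κF, κR, s, e, W)` from `ν₀` to `ν₁` with `e^{−ΔF} = Z₁/Z₀`, a positive
  measurable statistic `α` with `α e^{−W} ∈ L²(P_F)`, `α ∈ L²(P_R)`, block sizes `a, b ≥ 1`, along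
  the run of independent blocks `ω : ℕ → (Fin a → E) × (Fin b → E)` under
  `Measure.infinitePi (fun _ => P_F^{⊗a} ⊗ P_R^{⊗b})`, with the two-sample estimator of `e^{−ΔF}`
  from `a·n` forward and `b·n` reverse evolutions
  `R_n = [Σ_{k<n} Σ_{l<a} α(ε_{k,l}) e^{−W(ε_{k,l})} / (a n)] / [Σ_{k<n} Σ_{l<b} α(ε'_{k,l}) / (b n)]`:
  **`CrooksPair.tendstoInDistribution_twoSample_ratio_blocks`** —
  `√n (R_n − e^{−ΔF}) →d N(0, e^{−2ΔF} · V_{a,b}(α))`,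
  `V_{a,b}(α) = (E_F[(α e^{−W})²]/E_F[α e^{−W}]² − 1)/a + (E_R[α²]/E_R[α]² − 1)/b` —
  BENNETT'S VARIANCE FUNCTIONAL WITH `nf = a`, `nr = b` (GEN-11's `NCMCGeneralSpaceBennettOptimal.lean`),
  so that per forward/reverse evolution the variance is `(…−1)/nf + (…−1)/nr` as in Bennett's paper.
  Reading for the engine (`estimators.bar` / `twosided` with unequal leg sizes): for independent
  evolutions the honest large-sample error bar of the two-sample estimate with `nf` forward and `nr`
  reverse evolutions and statistic `α` is `√((1/ess_F − 1)/nf + (1/ess_R − 1)/nr)`-shaped in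
  population terms, `1/ESS − 1` being the squared coefficient of variation of each leg's weights.

Scope / NOT CLAIMED: a FIXED ratio `a : b` (the genuinely two-index limit `nf, nr → ∞` independently
is not covered); independent evolutions; a fixed statistic `α` (not the self-consistent BAR
iteration); the `−log` (free-energy) version and studentization are left to a companion file; no
rate, no finite-`n` coverage, no value for any concrete protocol.
-/

namespace Summit.Ventures.LatticeQCDFlow.Exactness.GeneralNCMC

open MeasureTheory ProbabilityTheory Set Filter Finset
open scoped ENNReal NNReal Topology

variable {E : Type*} [MeasurableSpace E]

/-! ## Block sums of i.i.d. coordinates -/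

section Block

variable (μ : Measure E) [IsProbabilityMeasure μ] {m : ℕ}

omit [IsProbabilityMeasure μ] in
/-- A block sum of a measurable function is measurable. -/
theorem measurable_blockSum {g : E → ℝ} (hg : Measurable g) :
    Measurable fun x : Fin m → E => ∑ l, g (x l) :=
  Finset.measurable_sum _ fun l _ => hg.comp (measurable_pi_apply l)

/-- A block sum of an `L²` function is in `L²` of the block law `μ^{⊗m}`. -/
theorem memLp_blockSum {g : E → ℝ} (hL2 : MemLp g 2 μ) :
    MemLp (fun x : Fin m → E => ∑ l, g (x l)) 2 (Measure.pi fun _ : Fin m => μ) :=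
  memLp_finsetSum _ fun l _ => hL2.comp_measurePreserving (measurePreserving_eval (fun _ : Fin m => μ) l)

/-- The mean of a block sum is `m E_μ g`. -/
theorem integral_blockSum {g : E → ℝ} (hgi : Integrable g μ) :
    ∫ x, ∑ l, g (x l) ∂(Measure.pi fun _ : Fin m => μ) = m * ∫ a, g a ∂μ := by
  have hint : ∀ l ∈ (univ : Finset (Fin m)),
      Integrable (fun x : Fin m → E => g (x l)) (Measure.pi fun _ : Fin m => μ) :=
    fun l _ => (measurePreserving_eval (fun _ : Fin m => μ) l).integrable_comp_of_integrable hgi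
  rw [integral_finsetSum _ hint]
  simp_rw [integral_comp_eval_pi μ _ hgi.aestronglyMeasurable]
  rw [Finset.sum_const, card_univ, Fintype.card_fin, nsmul_eq_mul]

/-- The variance of a block sum is `m Var_μ g` (independent coordinates, `variance_sum_pi`). -/
theorem variance_blockSum {g : E → ℝ} (hL2 : MemLp g 2 μ) :
    Var[fun x : Fin m → E => ∑ l, g (x l); Measure.pi fun _ : Fin m => μ] = m * Var[g; μ] := by
  have h := variance_sum_pi (μ := fun _ : Fin m => μ) (X := fun _ : Fin m => g) (fun _ => hL2)
  rw [Finset.sum_const, card_univ, Fintype.card_fin, nsmul_eq_mul] at h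
  rw [← h]
  congr 1
  funext x
  simp only [Finset.sum_apply]

end Block

/-- On a product of two probability spaces, `Var[f(x) − θ g(y)] = Var f + θ² Var g` (the two
coordinates are independent; two-type version of GEN-12's `variance_fst_sub_mul_snd`). -/
theorem variance_fst_sub_mul_snd' {X₁ X₂ : Type*} [MeasurableSpace X₁] [MeasurableSpace X₂]
    (μF : Measure X₁) (μR : Measure X₂) [IsProbabilityMeasure μF] [IsProbabilityMeasure μR]
    {f : X₁ → ℝ} {g : X₂ → ℝ} (hf : Measurable f) (hg : Measurable g) (hf2 : MemLp f 2 μF)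
    (hg2 : MemLp g 2 μR) (θ : ℝ) :
    Var[fun p : X₁ × X₂ => f p.1 - θ * g p.2; μF.prod μR] = Var[f; μF] + θ ^ 2 * Var[g; μR] := by
  have hind : IndepFun (fun p : X₁ × X₂ => f p.1) (fun p : X₁ × X₂ => -(θ * g p.2)) (μF.prod μR) :=
    indepFun_prod (μ := μF) (ν := μR) (X := f) (Y := fun y => -(θ * g y)) hf (hg.const_mul θ).neg
  have hf2' : MemLp (fun p : X₁ × X₂ => f p.1) 2 (μF.prod μR) :=
    hf2.comp_measurePreserving (measurePreserving_fst (μ := μF) (ν := μR))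
  have hg2' : MemLp (fun p : X₁ × X₂ => g p.2) 2 (μF.prod μR) :=
    hg2.comp_measurePreserving (measurePreserving_snd (μ := μF) (ν := μR))
  have hg2'' : MemLp (fun p : X₁ × X₂ => -(θ * g p.2)) 2 (μF.prod μR) := (hg2'.const_mul θ).neg
  have hsum := hind.variance_fun_add hf2' hg2''
  have hform : (fun p : X₁ × X₂ => f p.1 - θ * g p.2) = fun p => f p.1 + -(θ * g p.2) := by
    funext p
    ring
  have hidF : IdentDistrib (fun p : X₁ × X₂ => f p.1) f (μF.prod μR) μF :=
    { aemeasurable_fst := (hf.comp measurable_fst).aemeasurable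
      aemeasurable_snd := hf.aemeasurable
      map_eq := by
        rw [show (fun p : X₁ × X₂ => f p.1) = f ∘ Prod.fst from rfl,
          ← Measure.map_map hf measurable_fst, (measurePreserving_fst (μ := μF) (ν := μR)).map_eq] }
  have hidR : IdentDistrib (fun p : X₁ × X₂ => g p.2) g (μF.prod μR) μR :=
    { aemeasurable_fst := (hg.comp measurable_snd).aemeasurable
      aemeasurable_snd := hg.aemeasurable
      map_eq := by
        rw [show (fun p : X₁ × X₂ => g p.2) = g ∘ Prod.snd from rfl,
          ← Measure.map_map hg measurable_snd, (measurePreserving_snd (μ := μF) (ν := μR)).map_eq] }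
  rw [hform, hsum, variance_fun_neg, variance_const_mul, hidF.variance_eq, hidR.variance_eq]

/-- `√n · ((x/(a n))/(y/(b n)) − θ) = (b/a) · (√n · (x/y − ρ))` when `(b/a)ρ = θ` and `y ≠ 0` for
`n ≠ 0` (the block counts cancel). -/
theorem sqrt_mul_blockRatio_sub_eq (n a b : ℕ) (ha : a ≠ 0) (hb : b ≠ 0) {x y ρ θ : ℝ}
    (hρ : (b : ℝ) / a * ρ = θ) (hy : n ≠ 0 → y ≠ 0) :
    √(n : ℝ) * (x / (a * n) / (y / (b * n)) - θ) = (b : ℝ) / a * (√(n : ℝ) * (x / y - ρ)) := by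
  rcases Nat.eq_zero_or_pos n with rfl | hn
  · simp
  · have hn' : (n : ℝ) ≠ 0 := by exact_mod_cast hn.ne'
    have ha' : (a : ℝ) ≠ 0 := by exact_mod_cast ha
    have hb' : (b : ℝ) ≠ 0 := by exact_mod_cast hb
    have hy' : y ≠ 0 := hy hn.ne'
    rw [← hρ]
    field_simp

/-! ## For a Crooks pair: the two-sample estimator from `a·n` forward and `b·n` reverse evolutions -/

namespace CrooksPair

variable {Ω : Type*} [MeasurableSpace Ω]
variable {ν₀ ν₁ : Measure Ω} {κF κR : Kernel Ω E} {s e : E → Ω} {W : E → ℝ}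
variable {Ω' : Type*} [MeasurableSpace Ω'] {P' : Measure Ω'} [IsProbabilityMeasure P']

/-- **Asymptotic normality of the two-sample estimator with sample-size ratio `a : b`.**  For every
Crooks pair with `e^{−ΔF} = Z₁/Z₀`, every positive measurable statistic `α` with
`α e^{−W} ∈ L²(P_F)`, `α ∈ L²(P_R)`, and block sizes `a, b ≥ 1`, along an infinite run of
independent blocks (each: `a` forward evolutions from prior equilibrium, `b` reverse evolutions from
target equilibrium), the estimator `R_n` of `e^{−ΔF}` built from the first `n` blocks — the ratio of
the forward sample mean of `α e^{−W}` over `a·n` evolutions to the reverse sample mean of `α` over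
`b·n` evolutions — satisfies `√n (R_n − e^{−ΔF}) →d N(0, e^{−2ΔF} · V_{a,b}(α))`,
`V_{a,b}(α) = (E_F[(α e^{−W})²]/E_F[α e^{−W}]² − 1)/a + (E_R[α²]/E_R[α]² − 1)/b`. -/
theorem tendstoInDistribution_twoSample_ratio_blocks [IsFiniteMeasure ν₀] [IsFiniteMeasure ν₁]
    [IsMarkovKernel κF] [IsMarkovKernel κR] (h0 : ν₀ univ ≠ 0) (h1 : ν₁ univ ≠ 0)
    (h : CrooksPair ν₀ ν₁ κF κR s e W) {α : E → ℝ} (hαm : Measurable α) (hαpos : ∀ ε, 0 < α ε)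
    (hA2 : MemLp (fun ε => α ε * Real.exp (-W ε)) 2 (fwdPathLaw ν₀ κF))
    (hB2 : MemLp α 2 (fwdPathLaw ν₁ κR)) {ΔF : ℝ}
    (hΔF : Real.exp (-ΔF) = ((ν₀ univ)⁻¹ * ν₁ univ).toReal) {a b : ℕ} (ha : 0 < a) (hb : 0 < b)
    {Y : Ω' → ℝ}
    (hY : HasLaw Y (gaussianReal 0 (Real.exp (-ΔF) ^ 2 *
      (((∫ ε, (α ε * Real.exp (-W ε)) ^ 2 ∂(fwdPathLaw ν₀ κF)) /
          (∫ ε, α ε * Real.exp (-W ε) ∂(fwdPathLaw ν₀ κF)) ^ 2 - 1) / a +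
        ((∫ ε, α ε ^ 2 ∂(fwdPathLaw ν₁ κR)) / (∫ ε, α ε ∂(fwdPathLaw ν₁ κR)) ^ 2 - 1) / b)).toNNReal)
      P') :
    haveI := isProbabilityMeasure_fwdPathLaw ν₀ h0 κF
    haveI := isProbabilityMeasure_fwdPathLaw ν₁ h1 κR
    TendstoInDistribution
      (fun (n : ℕ) (ω : ℕ → (Fin a → E) × (Fin b → E)) => √(n : ℝ) *
        ((∑ k ∈ range n, ∑ l, α ((ω k).1 l) * Real.exp (-W ((ω k).1 l))) / (a * n) /
          ((∑ k ∈ range n, ∑ l, α ((ω k).2 l)) / (b * n)) - Real.exp (-ΔF)))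
      atTop Y (fun _ => Measure.infinitePi fun _ : ℕ =>
        (Measure.pi fun _ : Fin a => fwdPathLaw ν₀ κF).prod (Measure.pi fun _ : Fin b => fwdPathLaw ν₁ κR))
      P' := by
  haveI := isProbabilityMeasure_fwdPathLaw ν₀ h0 κF
  haveI := isProbabilityMeasure_fwdPathLaw ν₁ h1 κR
  set PF := fwdPathLaw ν₀ κF with hPF
  set PR := fwdPathLaw ν₁ κR with hPR
  set μF := Measure.pi fun _ : Fin a => PF with hμF
  set μR := Measure.pi fun _ : Fin b => PR with hμR
  set μ := μF.prod μR with hμ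
  haveI : Nonempty (Fin b) := Fin.pos_iff_nonempty.1 hb
  -- the two block sums, as functions on a block
  have hgm : Measurable fun ε => α ε * Real.exp (-W ε) :=
    hαm.mul (Real.measurable_exp.comp h.measurable_W.neg)
  have hfA : Measurable fun x : Fin a → E => ∑ l, α (x l) * Real.exp (-W (x l)) := measurable_blockSum hgm
  have hgB : Measurable fun y : Fin b → E => ∑ l, α (y l) := measurable_blockSum hαm
  have ham : Measurable fun p : (Fin a → E) × (Fin b → E) => ∑ l, α (p.1 l) * Real.exp (-W (p.1 l)) :=
    hfA.comp measurable_fst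
  have hbm : Measurable fun p : (Fin a → E) × (Fin b → E) => ∑ l, α (p.2 l) := hgB.comp measurable_snd
  have hfA2 : MemLp (fun x : Fin a → E => ∑ l, α (x l) * Real.exp (-W (x l))) 2 μF :=
    memLp_blockSum PF hA2
  have hgB2 : MemLp (fun y : Fin b → E => ∑ l, α (y l)) 2 μR := memLp_blockSum PR hB2
  have ha2 : MemLp (fun p : (Fin a → E) × (Fin b → E) => ∑ l, α (p.1 l) * Real.exp (-W (p.1 l))) 2 μ :=
    hfA2.comp_measurePreserving (measurePreserving_fst (μ := μF) (ν := μR))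
  have hb2 : MemLp (fun p : (Fin a → E) × (Fin b → E) => ∑ l, α (p.2 l)) 2 μ :=
    hgB2.comp_measurePreserving (measurePreserving_snd (μ := μF) (ν := μR))
  have hbpos : ∀ p : (Fin a → E) × (Fin b → E), 0 < ∑ l, α (p.2 l) :=
    fun p => Finset.sum_pos (fun l _ => hαpos (p.2 l)) Finset.univ_nonempty
  -- means
  set mA := ∫ ε, α ε * Real.exp (-W ε) ∂PF with hmA
  set mB := ∫ ε, α ε ∂PR with hmB
  have hia : ∫ p, ∑ l, α (p.1 l) * Real.exp (-W (p.1 l)) ∂μ = a * mA := by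
    rw [integral_comp_of_measurePreserving (measurePreserving_fst (μ := μF) (ν := μR))
      (hfA2.integrable one_le_two).aestronglyMeasurable, hmA]
    exact integral_blockSum PF (hA2.integrable one_le_two)
  have hib : ∫ p, ∑ l, α (p.2 l) ∂μ = b * mB := by
    rw [integral_comp_of_measurePreserving (measurePreserving_snd (μ := μF) (ν := μR))
      (hgB2.integrable one_le_two).aestronglyMeasurable, hmB]
    exact integral_blockSum PR (hB2.integrable one_le_two)
  have hB : 0 < mB := by
    rw [hmB, integral_pos_iff_support_of_nonneg (fun ε => (hαpos ε).le) (hB2.integrable one_le_two)]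
    have hsupp : Function.support α = univ := by
      ext ε
      simp only [Function.mem_support, mem_univ, iff_true]
      exact (hαpos ε).ne'
    rw [hsupp, measure_univ]
    exact one_pos
  have htwo : mA = Real.exp (-ΔF) * mB := by
    have := h.integral_exp_neg_work_mul h0 h1 hΔF α
    rw [hmA, hmB, ← this]
    refine integral_congr_ae (Eventually.of_forall fun ε => ?_)
    simp only
    ring
  have hA : 0 < mA := by rw [htwo]; exact mul_pos (Real.exp_pos _) hB
  have ha' : (a : ℝ) ≠ 0 := by exact_mod_cast ha.ne'
  have hb' : (b : ℝ) ≠ 0 := by exact_mod_cast hb.ne'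
  set ρ := (a : ℝ) * mA / (b * mB) with hρdef
  have hratio : (∫ p, ∑ l, α (p.1 l) * Real.exp (-W (p.1 l)) ∂μ) / (∫ p, ∑ l, α (p.2 l) ∂μ) = ρ := by
    rw [hia, hib]
  have hρθ : (b : ℝ) / a * ρ = Real.exp (-ΔF) := by
    rw [hρdef, htwo]
    field_simp
  -- the variance of `A − ρ B` over `(b mB)²`, against `Y' = (a/b)·Y`
  have hvar : Var[fun p : (Fin a → E) × (Fin b → E) => ∑ l, α (p.1 l) * Real.exp (-W (p.1 l)) -
      (∫ p, ∑ l, α (p.1 l) * Real.exp (-W (p.1 l)) ∂μ) / (∫ p, ∑ l, α (p.2 l) ∂μ) * ∑ l, α (p.2 l); μ] /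
        (∫ p, ∑ l, α (p.2 l) ∂μ) ^ 2 =
      ((a : ℝ) / b) ^ 2 * (Real.exp (-ΔF) ^ 2 *
        (((∫ ε, (α ε * Real.exp (-W ε)) ^ 2 ∂PF) / mA ^ 2 - 1) / a +
          ((∫ ε, α ε ^ 2 ∂PR) / mB ^ 2 - 1) / b)) := by
    rw [hratio, hib, variance_fst_sub_mul_snd' μF μR hfA hgB hfA2 hgB2 ρ, variance_blockSum PF hA2,
      variance_blockSum PR hB2, variance_eq_sub hA2, variance_eq_sub hB2, ← hmA, ← hmB, hρdef, htwo]
    simp only [Pi.pow_apply]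
    have hθ : Real.exp (-ΔF) ≠ 0 := (Real.exp_pos _).ne'
    field_simp
  have hY' : HasLaw (fun ω' => (a : ℝ) / b * Y ω') (gaussianReal 0
      (Var[fun p : (Fin a → E) × (Fin b → E) => ∑ l, α (p.1 l) * Real.exp (-W (p.1 l)) -
        (∫ p, ∑ l, α (p.1 l) * Real.exp (-W (p.1 l)) ∂μ) / (∫ p, ∑ l, α (p.2 l) ∂μ) * ∑ l, α (p.2 l); μ] /
        (∫ p, ∑ l, α (p.2 l) ∂μ) ^ 2).toNNReal) P' := by
    have hg := gaussianReal_const_mul hY ((a : ℝ) / b)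
    rw [mul_zero] at hg
    rw [hvar]
    convert hg using 3
    apply NNReal.eq
    have hnn : 0 ≤ Real.exp (-ΔF) ^ 2 *
        (((∫ ε, (α ε * Real.exp (-W ε)) ^ 2 ∂PF) / mA ^ 2 - 1) / a +
          ((∫ ε, α ε ^ 2 ∂PR) / mB ^ 2 - 1) / b) := by
      have h1' : 0 ≤ (∫ ε, (α ε * Real.exp (-W ε)) ^ 2 ∂PF) / mA ^ 2 - 1 := by
        have hv := variance_nonneg (fun ε => α ε * Real.exp (-W ε)) PF
        rw [variance_eq_sub hA2] at hv
        simp only [Pi.pow_apply] at hv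
        rw [sub_nonneg, le_div_iff₀ (pow_pos hA 2), one_mul, hmA]
        linarith
      have h2' : 0 ≤ (∫ ε, α ε ^ 2 ∂PR) / mB ^ 2 - 1 := by
        have hv := variance_nonneg α PR
        rw [variance_eq_sub hB2] at hv
        simp only [Pi.pow_apply] at hv
        rw [sub_nonneg, le_div_iff₀ (pow_pos hB 2), one_mul, hmB]
        linarith
      positivity
    rw [Real.coe_toNNReal _ (mul_nonneg (sq_nonneg _) hnn), NNReal.coe_mul, NNReal.coe_mk,
      Real.coe_toNNReal _ hnn]
  have main := tendstoInDistribution_sqrt_mul_ratio_sub μ ham hbm hbpos ha2 hb2 hY'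
  rw [hratio] at main
  -- rescale by `b/a`: `R_n − θ = (b/a)(Σ A/Σ B − ρ)`
  have hresc := main.continuous_comp (g := fun x : ℝ => (b : ℝ) / a * x) (by fun_prop)
  have hlim : ((fun x : ℝ => (b : ℝ) / a * x) ∘ fun ω' => (a : ℝ) / b * Y ω') = Y := by
    funext ω'
    simp only [Function.comp_apply]
    field_simp
  rw [hlim] at hresc
  refine hresc.congr (fun n => Eventually.of_forall fun ω => ?_) (Eventually.of_forall fun _ => rfl)
  simp only [Function.comp_apply]
  exact (sqrt_mul_blockRatio_sub_eq n a b ha.ne' hb.ne' hρθ fun hn =>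
    (Finset.sum_pos (fun k _ => hbpos (ω k)) (nonempty_range_iff.2 hn)).ne').symm

end CrooksPair

end Summit.Ventures.LatticeQCDFlow.Exactness.GeneralNCMC
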